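import Literature.AnabelianGeometry.SemiGraphs.CommensurabilityProofs4
import Literature.AnabelianGeometry.SemiGraphs.OfProfiniteGroupsProofs

/-!
# The one-vertex sub-semi-graph: `Π_{{v}} = Π_v` ([SemiAnbd] §2, p. 27)

Companion (theorems only) of `GraphOfAnabelioids.lean` / `Commensurability.lean`.  [SemiAnbd],
proof of Proposition 2.5 (p. 27): "the morphism `Π_v → Π_𝒢` may be considered as a special case of
the morphism `Π_ℍ → Π_𝒢` [i.e., the case where `ℍ` consists of a single vertex and no edges]".  In
t1's model this is the statement that for the sub-semi-graph `{v}` (one vertex, no edges) the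
restriction `ρ : B(𝒢_{{v}}) ⥤ 𝒢_v` is an equivalence, so that the images of `Π_{{v}} → Π_𝒢` and
`Π_v → Π_𝒢` in `Π_𝒢` coincide (`range_piHToPi_single`); also `{v}` is connected.  Serves the
reduction of Cor. 2.7 (i) (vertex clause from the sub-semi-graph clause).
-/

namespace Literature.AnabelianGeometry.SemiGraphs

open CategoryTheory CategoryTheory.PreGaloisCategory
open Literature.AnabelianGeometry.Anabelioids

universe v₁ u₁ u

namespace SemiGraphOfAnabelioids

variable (𝒢 : SemiGraphOfAnabelioids.{v₁, u₁, u}) (v : 𝒢.graph.Vertex)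

/-- `ρ_v : B(𝒢_{{v}}) ⥤ 𝒢_v` is faithful for the one-vertex edgeless sub-semi-graph.
[cite: MochizukiSemiAnbd2006, Prop. 2.5 p.27] -/
theorem single_ρ_faithful :
    ((𝒢.restrict ⟨{v}, ∅⟩).ρ ⟨v, Set.mem_singleton v⟩).Faithful := by
  refine ⟨fun {X Y} f g h => ?_⟩
  apply BObj.hom_ext
  · funext w
    obtain ⟨w, hw⟩ := w
    cases hw
    exact h
  · funext e
    exact e.2.elim

/-- `ρ_v : B(𝒢_{{v}}) ⥤ 𝒢_v` is full for the one-vertex edgeless sub-semi-graph.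
[cite: MochizukiSemiAnbd2006, Prop. 2.5 p.27] -/
theorem single_ρ_full :
    ((𝒢.restrict ⟨{v}, ∅⟩).ρ ⟨v, Set.mem_singleton v⟩).Full := by
  refine ⟨fun {X Y} g => ?_⟩
  refine ⟨{ fS := fun w => ?_, fT := fun e => e.2.elim, comm := fun b => b.2.elim }, ?_⟩
  · obtain ⟨w, hw⟩ := w
    cases hw
    exact g
  · rfl

/-- `ρ_v : B(𝒢_{{v}}) ⥤ 𝒢_v` is essentially surjective for the one-vertex edgeless
sub-semi-graph. [cite: MochizukiSemiAnbd2006, Prop. 2.5 p.27] -/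
theorem single_ρ_essSurj :
    ((𝒢.restrict ⟨{v}, ∅⟩).ρ ⟨v, Set.mem_singleton v⟩).EssSurj := by
  refine ⟨fun Y => ⟨
    { S := fun w => cast (congrArg 𝒢.V (Set.mem_singleton_iff.mp w.2).symm) Y
      T := fun e => e.2.elim
      ψ := fun b => b.2.elim }, ⟨Iso.refl _⟩⟩⟩

/-- `ρ_v : B(𝒢_{{v}}) ⥤ 𝒢_v` is an equivalence of categories for the one-vertex edgeless
sub-semi-graph `{v}`. [cite: MochizukiSemiAnbd2006, Prop. 2.5 p.27] -/
theorem single_ρ_isEquivalence :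
    ((𝒢.restrict ⟨{v}, ∅⟩).ρ ⟨v, Set.mem_singleton v⟩).IsEquivalence :=
  { faithful := single_ρ_faithful 𝒢 v
    full := single_ρ_full 𝒢 v
    essSurj := single_ρ_essSurj 𝒢 v }

/-- **`Π_{{v}} = Π_v` in `Π_𝒢`**: the images of `Π_ℍ → Π_𝒢` for `ℍ = {v}` (one vertex, no edges)
and of `Π_v → Π_𝒢` coincide ([SemiAnbd] p. 27: "`Π_v → Π_𝒢` may be considered as a special case of
the morphism `Π_ℍ → Π_𝒢`"). [cite: MochizukiSemiAnbd2006, Prop. 2.5 p.27] -/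
theorem range_piHToPi_single (F : 𝒢.V v ⥤ FintypeCat.{v₁}) :
    (𝒢.piHToPi ⟨{v}, ∅⟩ ⟨v, Set.mem_singleton v⟩ F).range = (𝒢.piVToPi v F).range := by
  have hcomp := piHToPi_comp_piVToPi 𝒢 ⟨{v}, ∅⟩ ⟨v, Set.mem_singleton v⟩ F
  haveI := single_ρ_isEquivalence 𝒢 v
  have hsurj : Function.Surjective ((𝒢.restrict ⟨{v}, ∅⟩).piVToPi ⟨v, Set.mem_singleton v⟩ F) :=
    (pi1Map_bijective_of_isEquivalence
      ((𝒢.restrict ⟨{v}, ∅⟩).ρ ⟨v, Set.mem_singleton v⟩) F).2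
  apply le_antisymm
  · rintro x ⟨σ, rfl⟩
    obtain ⟨τ, rfl⟩ := hsurj σ
    exact ⟨τ, (DFunLike.congr_fun hcomp τ).symm⟩
  · rintro x ⟨τ, rfl⟩
    exact ⟨(𝒢.restrict ⟨{v}, ∅⟩).piVToPi ⟨v, Set.mem_singleton v⟩ F τ, DFunLike.congr_fun hcomp τ⟩

/-- The one-vertex edgeless sub-semi-graph `{v}` is connected. [cite: MochizukiSemiAnbd2006, §1 p.12] -/
theorem single_isConnected :
    (⟨{v}, ∅⟩ : 𝒢.graph.Subgraph).toSemiGraph.IsConnected := by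
  haveI : Nonempty (⟨{v}, ∅⟩ : 𝒢.graph.Subgraph).toSemiGraph.Node :=
    ⟨Sum.inl ⟨v, Set.mem_singleton v⟩⟩
  refine ⟨⟨fun x y => ?_⟩⟩
  have hx : x = Sum.inl ⟨v, Set.mem_singleton v⟩ := by
    rcases x with ⟨w, hw⟩ | (⟨e, he⟩ | ⟨b, hb⟩)
    · cases hw; rfl
    · exact he.elim
    · exact hb.elim
  have hy : y = Sum.inl ⟨v, Set.mem_singleton v⟩ := by
    rcases y with ⟨w, hw⟩ | (⟨e, he⟩ | ⟨b, hb⟩)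
    · cases hw; rfl
    · exact he.elim
    · exact hb.elim
  subst hx hy
  exact SimpleGraph.Reachable.refl _

end SemiGraphOfAnabelioids

end Literature.AnabelianGeometry.SemiGraphs
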